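import Summits.MatrixMultiplication.OmegaCensus.STPP211CosetEngine

/-!
# (2,1,1)¹⁰ ⊄ (ℤ/2)⁶ — part D3: coset-law kernel decisions (#15, #18, #19, #28)

Cell `pub-omega` (unit `pub-omega-stpp-1-g36`), topic `Summits/MatrixMultiplication/OmegaCensus`.
HONEST FRAMING (verbatim): lottery ticket; floor = certified bounds/negative ranges. Census STRUCTURE bookkeeping (B5, `T1((ℤ/2)⁶)`, Pb237);
nothing here is a bound on `ω`.

The `c`-code lists are representatives of the `AGL(6,2)`-classes of 10-subsets `C ∋ 0` of `𝔽₂⁶` (ENG2 g35's mass-formula-certified list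
`orbits_m6_k10.txt`; numbering = its line order). Classes of affine dimension `≤ 5` (all codes `< 32`): hyperplane «bit 5 = 0», threshold
`T = 10` (`csNN`). Classes #16, #24, #26 (affine dimension 6, nine of the ten points in the hyperplane «bit 0 = 0»): the nine EVEN codes,
threshold `T = 9` (`csNNi`). Each `decide +kernel` evaluates the SALTED search `T1CosetEng.searchS` (`STPP211CosetEngine`, v2); desk twins
`labm.c` / `engine_mirror.py` (HOME `pub-omega-stpp-1-g36/code/`) give the call counts quoted. The theorems these become: `STPP211Z2pow6CosetKills`
(via `STPP211CosetReflectB.cosetBound_of_searchS` and the coset law `STPP211CosetLaw`).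

References: H. Cohn, R. Kleinberg, B. Szegedy, C. Umans, FOCS 2005 (arXiv:math/0511460), Def. 5.1.
-/

namespace Summit.MatrixMultiplication.OmegaCensus

namespace T1CosetEng

/-- Class #15: the `c`-codes `0 1 2 4 8 14 16 22 27 29` (affine dimension ≤ 5). -/
def cs15 : List ℕ := [0, 1, 2, 4, 8, 14, 16, 22, 27, 29]

/-- KERNEL (200842 calls at the desk): no rooted admissible labeled set of class #15 in the hyperplane «bit 5 = 0» has 10 members. -/
theorem searchS_cs15 : searchS cs15 5 10 = true := by decide +kernel

/-- Class #18: the `c`-codes `0 1 2 4 8 15 16 17 22 23` (affine dimension ≤ 5). -/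
def cs18 : List ℕ := [0, 1, 2, 4, 8, 15, 16, 17, 22, 23]

/-- KERNEL (149007 calls at the desk): no rooted admissible labeled set of class #18 in the hyperplane «bit 5 = 0» has 10 members. -/
theorem searchS_cs18 : searchS cs18 5 10 = true := by decide +kernel

/-- Class #19: the `c`-codes `0 1 2 4 8 15 16 23 27 28` (affine dimension ≤ 5). -/
def cs19 : List ℕ := [0, 1, 2, 4, 8, 15, 16, 23, 27, 28]

/-- KERNEL (123143 calls at the desk): no rooted admissible labeled set of class #19 in the hyperplane «bit 5 = 0» has 10 members. -/
theorem searchS_cs19 : searchS cs19 5 10 = true := by decide +kernel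

/-- Class #28: the `c`-codes `0 1 2 4 8 9 15 16 17 23` (affine dimension ≤ 5). -/
def cs28 : List ℕ := [0, 1, 2, 4, 8, 9, 15, 16, 17, 23]

/-- KERNEL (114463 calls at the desk): no rooted admissible labeled set of class #28 in the hyperplane «bit 5 = 0» has 10 members. -/
theorem searchS_cs28 : searchS cs28 5 10 = true := by decide +kernel

end T1CosetEng

end Summit.MatrixMultiplication.OmegaCensus
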